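import Summits.Ventures.PercRepro.Graph

/-!
# The two-cluster theorem and the principal-cube theorem (mine-3's Lean sheet; p6, gen 18)

mine-3's MINE3-TWOCLUSTER-LEANSHEET (proofs/MINE3-GLUING.md §41 (a)–(b)), typed on typer-1's
`Config / MultiGraph / Conn / cluster` — a pure graph statement, no probability.

* `WalkAvoiding ω W u v`: `u` and `v` are joined by an `ω`-open walk none of whose vertices lies in `W`;
  `WalkInside ω Y u v`: joined by an `ω`-open walk all of whose vertices lie in `Y` (both as
  `Relation.ReflTransGen` of the restricted open adjacency, with the start vertex constrained).
* **THEOREM (two clusters, `two_cluster`).** For vertex sets `Y₁, Y₂` and configurations `ω, τ`: if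
  `Y₁, Y₂` are disjoint, every vertex of `Y₂` reaches `b` inside `Y₂` by `ω`-open edges, every vertex
  of `Y₁` reaches `a` inside `Y₁` by `τ`-open edges, and some walk open in both `ω` and `τ` leads from
  `c` into `Y₁` with all its vertices before the last outside `Y₁`, then `c` reaches `b` in `ω`
  avoiding `Y₁`, or `c` reaches `a` in `τ` avoiding `Y₂`.  (The walk is a `ReflTransGen` of
  «`OpenAdj (ω ⊓ τ) x y ∧ x ∉ Y₁`» ending in `Y₁`; `exists_first_mem_of_conn` produces it from
  `G.Conn S c a` by cutting an `S`-open path at its first vertex in `Y₁`.)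
* **COROLLARY (cube complement, `good_or_good_compl`).** For a configuration `S` with `c ~_S a` and
  disjoint blue clusters of `a` and `b` (red type `D`, blue type `A` suffice), and any set `X` of
  `S`-blue edges with complement `X' = Sᶜ ⊓ Xᶜ`: with `T = S ⊔ X`, `T' = S ⊔ X'`, either `c` reaches
  `b` in `T` avoiding the blue cluster of `a` in `T` («`T ∈ Good₁`»), or `c` reaches `a` in `T'`
  avoiding the blue cluster of `b` in `T'` («`T' ∈ Good₂`»).
* **THEOREM (principal cube, `card_cube_le_good_add_good`).** The cube `{T : S ≤ T}` above such an
  `S` satisfies `#cube ≤ #{T ∈ cube : Good₁ T} + #{T ∈ cube : Good₂ T}` — the average Good-degree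
  over the cube above any `(D,A)` source is at least `1` — by the involution `T ↦ S ⊔ (Sᶜ ⊓ Tᶜ)` of
  the cube and the corollary.  (Engine-exhaustive to `n = 8`: 1,442,125,065 pairs, 0 failures,
  minimum exactly `1` — INBOX 10047.)
-/

namespace PercRepro

namespace MultiGraph

open Finset

variable {V E : Type*} (G : MultiGraph V E)

/-- `G.WalkAvoiding ω W u v`: `u` and `v` are joined by an `ω`-open walk none of whose vertices lies in
`W` (the start vertex `u` included). -/
def WalkAvoiding (ω : Config E) (W : Set V) (u v : V) : Prop :=
  u ∉ W ∧ Relation.ReflTransGen (fun x y => G.OpenAdj ω x y ∧ y ∉ W) u v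

/-- `G.WalkInside ω Y u v`: `u` and `v` are joined by an `ω`-open walk all of whose vertices lie in
`Y` (the start vertex `u` included). -/
def WalkInside (ω : Config E) (Y : Set V) (u v : V) : Prop :=
  u ∈ Y ∧ Relation.ReflTransGen (fun x y => G.OpenAdj ω x y ∧ y ∈ Y) u v

variable {G}

omit G in
/-- Monotonicity of the reflexive-transitive closure in the relation (the form used below). -/
theorem reflTransGen_of_imp {α : Type*} {r p : α → α → Prop} (h : ∀ x y, r x y → p x y) {u v : α}
    (huv : Relation.ReflTransGen r u v) : Relation.ReflTransGen p u v := by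
  induction huv with
  | refl => exact Relation.ReflTransGen.refl
  | tail _ hbc ih => exact ih.tail (h _ _ hbc)

/-- A walk inside `Y` avoids every set disjoint from `Y`. -/
theorem WalkInside.walkAvoiding {ω : Config E} {Y W : Set V} (hYW : Disjoint Y W) {u v : V}
    (h : G.WalkInside ω Y u v) : G.WalkAvoiding ω W u v :=
  ⟨Set.disjoint_left.1 hYW h.1,
    reflTransGen_of_imp (fun _ _ hxy => ⟨hxy.1, Set.disjoint_left.1 hYW hxy.2⟩) h.2⟩

/-- Prepending an open edge at a vertex outside `W` to an avoiding walk. -/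
theorem WalkAvoiding.head {ω : Config E} {W : Set V} {u x v : V} (hu : u ∉ W)
    (hux : G.OpenAdj ω u x) (h : G.WalkAvoiding ω W x v) : G.WalkAvoiding ω W u v :=
  ⟨hu, Relation.ReflTransGen.head ⟨hux, h.1⟩ h.2⟩

/-- An avoiding walk is an ordinary connection. -/
theorem WalkAvoiding.conn {ω : Config E} {W : Set V} {u v : V} (h : G.WalkAvoiding ω W u v) :
    G.Conn ω u v :=
  reflTransGen_of_imp (fun _ _ hxy => hxy.1) h.2

/-- A walk within `Y` is an ordinary connection. -/
theorem WalkInside.conn {ω : Config E} {Y : Set V} {u v : V} (h : G.WalkInside ω Y u v) :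
    G.Conn ω u v :=
  reflTransGen_of_imp (fun _ _ hxy => hxy.1) h.2

/-- Walks within `Y` are monotone in the configuration. -/
theorem WalkInside.mono {ω ω' : Config E} (hle : ω ≤ ω') {Y : Set V} {u v : V}
    (h : G.WalkInside ω Y u v) : G.WalkInside ω' Y u v :=
  ⟨h.1, reflTransGen_of_imp (fun _ _ hxy => ⟨hxy.1.mono hle, hxy.2⟩) h.2⟩

/-- **First hitting**: an open path from `u` to a vertex of `Y` can be cut at its first vertex in
`Y`: there is `w ∈ Y` reached from `u` by a walk all of whose vertices before `w` lie outside `Y`. -/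
theorem exists_first_mem_of_conn {ω : Config E} {Y : Set V} {u v : V} (h : G.Conn ω u v)
    (hv : v ∈ Y) :
    ∃ w ∈ Y, Relation.ReflTransGen (fun x y => G.OpenAdj ω x y ∧ x ∉ Y) u w := by
  unfold Conn at h
  induction h using Relation.ReflTransGen.head_induction_on with
  | refl => exact ⟨v, hv, Relation.ReflTransGen.refl⟩
  | @head u x hux _ ih =>
    by_cases hu : u ∈ Y
    · exact ⟨u, hu, Relation.ReflTransGen.refl⟩
    · obtain ⟨w, hw, hxw⟩ := ih
      exact ⟨w, hw, Relation.ReflTransGen.head ⟨hux, hu⟩ hxw⟩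

/-- Every vertex of an open cluster reaches the cluster's root by a walk inside the cluster, in
any configuration at least as open. -/
theorem walkInside_cluster_of_le {ω ω' : Config E} (hle : ω ≤ ω') {v x : V}
    (hx : x ∈ G.cluster ω v) : G.WalkInside ω' (G.cluster ω v) x v := by
  refine ⟨hx, ?_⟩
  have h : G.Conn ω x v := ((G.mem_cluster).1 hx).symm
  unfold Conn at h
  induction h using Relation.ReflTransGen.head_induction_on with
  | refl => exact Relation.ReflTransGen.refl
  | @head x y hxy hyv ih =>
    have hy : y ∈ G.cluster ω v := (G.mem_cluster).2 (Conn.symm (G := G) hyv)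
    exact Relation.ReflTransGen.head ⟨hxy.mono hle, hy⟩ (ih hy)

/-- **THEOREM (two clusters).** Vertex sets `Y₁, Y₂` and configurations `ω, τ` with
(H1) `Y₁, Y₂` disjoint; (H2) every vertex of `Y₂` reaches `b` inside `Y₂` by `ω`-open edges;
(H3) every vertex of `Y₁` reaches `a` inside `Y₁` by `τ`-open edges; (H4) a walk open in `ω` and
in `τ` leads from `c` to a vertex of `Y₁` with every vertex before the last outside `Y₁`.
Then `c` reaches `b` in `ω` avoiding `Y₁`, or `c` reaches `a` in `τ` avoiding `Y₂`. -/
theorem two_cluster {ω τ : Config E} {Y₁ Y₂ : Set V} {a b c : V} (h1 : Disjoint Y₁ Y₂)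
    (h2 : ∀ x ∈ Y₂, G.WalkInside ω Y₂ x b) (h3 : ∀ x ∈ Y₁, G.WalkInside τ Y₁ x a)
    (h4 : ∃ w ∈ Y₁, Relation.ReflTransGen (fun x y => G.OpenAdj (ω ⊓ τ) x y ∧ x ∉ Y₁) c w) :
    G.WalkAvoiding ω Y₁ c b ∨ G.WalkAvoiding τ Y₂ c a := by
  obtain ⟨w, hw, hwalk⟩ := h4
  induction hwalk using Relation.ReflTransGen.head_induction_on with
  | refl => exact Or.inr ((h3 w hw).walkAvoiding h1)
  | @head u x hux _ ih =>
    by_cases hu : u ∈ Y₂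
    · exact Or.inl ((h2 u hu).walkAvoiding h1.symm)
    · rcases ih with hl | hr
      · exact Or.inl (hl.head hux.2 (hux.1.mono inf_le_left))
      · exact Or.inr (hr.head hu (hux.1.mono inf_le_right))

/-- The clusters of `a` and `b` are disjoint when `a` and `b` are not joined. -/
theorem disjoint_cluster_of_not_conn {ω : Config E} {a b : V} (h : ¬ G.Conn ω a b) :
    Disjoint (G.cluster ω a) (G.cluster ω b) := by
  rw [Set.disjoint_left]
  intro u hua hub
  exact h (((G.mem_cluster).1 hua).trans ((G.mem_cluster).1 hub).symm)

/-- **COROLLARY (cube complement).** Let `S` have `c ~_S a` and disjoint blue clusters of `a` and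
`b`, and let `X` be a set of `S`-blue edges.  With `T = S ⊔ X` and `T' = S ⊔ (Sᶜ ⊓ Xᶜ)` (the
complementary set of blue edges opened), either `c` reaches `b` in `T` avoiding the blue cluster of
`a` in `T` («`T ∈ Good₁`»), or `c` reaches `a` in `T'` avoiding the blue cluster of `b` in `T'`
(«`T' ∈ Good₂`»). -/
theorem good_or_good_compl {S X : Config E} {a b c : V} (hca : G.Conn S c a)
    (hdisj : Disjoint (G.cluster Sᶜ a) (G.cluster Sᶜ b)) (hX : X ≤ Sᶜ) :
    G.WalkAvoiding (S ⊔ X) (G.cluster (S ⊔ X)ᶜ a) c b ∨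
      G.WalkAvoiding (S ⊔ (Sᶜ ⊓ Xᶜ)) (G.cluster (S ⊔ (Sᶜ ⊓ Xᶜ))ᶜ b) c a := by
  have hTc : (S ⊔ X)ᶜ = Sᶜ ⊓ Xᶜ := compl_sup
  have hT'c : (S ⊔ (Sᶜ ⊓ Xᶜ))ᶜ = X := by
    rw [compl_sup, compl_inf, compl_compl, compl_compl, inf_sup_left, compl_inf_eq_bot, bot_sup_eq,
      inf_eq_right.2 hX]
  refine two_cluster (Y₁ := G.cluster (S ⊔ X)ᶜ a) (Y₂ := G.cluster (S ⊔ (Sᶜ ⊓ Xᶜ))ᶜ b) ?_ ?_ ?_ ?_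
  · -- (H1): both blue clusters shrink when blue edges are opened
    refine hdisj.mono (G.cluster_mono ?_ a) (G.cluster_mono ?_ b)
    · rw [hTc]
      exact inf_le_left
    · rw [hT'c]
      exact hX
  · -- (H2): the blue edges of `T'` are `X`, open in `T`
    intro x hx
    exact walkInside_cluster_of_le (by rw [hT'c]; exact le_sup_right) hx
  · -- (H3): the blue edges of `T` are `Sᶜ ⊓ Xᶜ`, open in `T'`
    intro x hx
    exact walkInside_cluster_of_le (by rw [hTc]; exact le_sup_right) hx
  · -- (H4): an `S`-open path from `c` to `a`, cut at its first vertex in the blue cluster of `a`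
    obtain ⟨w, hw, hwalk⟩ := exists_first_mem_of_conn hca (G.self_mem_cluster (S ⊔ X)ᶜ a)
    exact ⟨w, hw, reflTransGen_of_imp
      (fun _ _ hxy => ⟨hxy.1.mono (le_inf le_sup_left le_sup_left), hxy.2⟩) hwalk⟩

section Cube

variable [Fintype E] [DecidableEq E]

omit [Fintype E] [DecidableEq E] in
/-- The map `T ↦ S ⊔ (Sᶜ ⊓ Tᶜ)` of the cube above `S` (complementing the opened blue edges) is an
involution on that cube. -/
theorem cube_compl_compl {S T : Config E} (hST : S ≤ T) :
    S ⊔ (Sᶜ ⊓ (S ⊔ (Sᶜ ⊓ Tᶜ))ᶜ) = T := by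
  rw [compl_sup, compl_inf, compl_compl, compl_compl, inf_left_idem, inf_sup_left,
    compl_inf_eq_bot, bot_sup_eq, inf_comm, ← sdiff_eq, sup_sdiff_cancel_right hST]

open Classical in
/-- **THEOREM (principal cube).** For `S` with `c ~_S a` and disjoint blue clusters of `a` and `b`
(every `(D,A)` configuration qualifies), the cube `{T : S ≤ T}` satisfies
`#cube ≤ #{T ∈ cube : Good₁ T} + #{T ∈ cube : Good₂ T}`, where `Good₁ T` is «`c` reaches `b` in
`T` avoiding the blue cluster of `a` in `T`» and `Good₂ T` is «`c` reaches `a` in `T` avoiding the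
blue cluster of `b` in `T`» — the average Good-degree over the cube above any `(D,A)` source is at
least `1`. -/
theorem card_cube_le_good_add_good {S : Config E} {a b c : V} (hca : G.Conn S c a)
    (hdisj : Disjoint (G.cluster Sᶜ a) (G.cluster Sᶜ b)) :
    (univ.filter fun T : Config E => S ≤ T).card ≤
      (univ.filter fun T : Config E => S ≤ T ∧ G.WalkAvoiding T (G.cluster Tᶜ a) c b).card +
      (univ.filter fun T : Config E => S ≤ T ∧ G.WalkAvoiding T (G.cluster Tᶜ b) c a).card := by
  -- the cube is covered by `Good₁` and the preimage of `Good₂` under the involution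
  have hcover : (univ.filter fun T : Config E => S ≤ T) ⊆
      (univ.filter fun T : Config E => S ≤ T ∧ G.WalkAvoiding T (G.cluster Tᶜ a) c b) ∪
      (univ.filter fun T : Config E => S ≤ T ∧
        G.WalkAvoiding (S ⊔ (Sᶜ ⊓ Tᶜ)) (G.cluster (S ⊔ (Sᶜ ⊓ Tᶜ))ᶜ b) c a) := by
    intro T hT
    simp only [mem_filter, mem_univ, true_and, mem_union] at hT ⊢
    have hX : Sᶜ ⊓ T ≤ Sᶜ := inf_le_left
    have hT' : S ⊔ (Sᶜ ⊓ T) = T := by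
      rw [inf_comm, ← sdiff_eq, sup_sdiff_cancel_right hT]
    have hT'' : Sᶜ ⊓ (Sᶜ ⊓ T)ᶜ = Sᶜ ⊓ Tᶜ := by
      rw [compl_inf, compl_compl, inf_sup_left, compl_inf_eq_bot, bot_sup_eq]
    rcases good_or_good_compl (X := Sᶜ ⊓ T) hca hdisj hX with h | h
    · rw [hT'] at h
      exact Or.inl ⟨hT, h⟩
    · rw [hT''] at h
      exact Or.inr ⟨hT, h⟩
  -- the preimage of `Good₂` under the involution has the same size as `Good₂`
  have hbij : (univ.filter fun T : Config E => S ≤ T ∧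
        G.WalkAvoiding (S ⊔ (Sᶜ ⊓ Tᶜ)) (G.cluster (S ⊔ (Sᶜ ⊓ Tᶜ))ᶜ b) c a).card =
      (univ.filter fun T : Config E => S ≤ T ∧ G.WalkAvoiding T (G.cluster Tᶜ b) c a).card := by
    refine Finset.card_bij (fun T _ => S ⊔ (Sᶜ ⊓ Tᶜ)) ?_ ?_ ?_
    · intro T hT
      simp only [mem_filter, mem_univ, true_and] at hT ⊢
      exact ⟨le_sup_left, hT.2⟩
    · intro T₁ hT₁ T₂ hT₂ h
      simp only [mem_filter, mem_univ, true_and] at hT₁ hT₂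
      have := congrArg (fun U => S ⊔ (Sᶜ ⊓ Uᶜ)) h
      simp only [cube_compl_compl hT₁.1, cube_compl_compl hT₂.1] at this
      exact this
    · intro T hT
      simp only [mem_filter, mem_univ, true_and] at hT
      refine ⟨S ⊔ (Sᶜ ⊓ Tᶜ), ?_, cube_compl_compl hT.1⟩
      simp only [mem_filter, mem_univ, true_and]
      refine ⟨le_sup_left, ?_⟩
      rw [cube_compl_compl hT.1]
      exact hT.2
  calc (univ.filter fun T : Config E => S ≤ T).card
      ≤ ((univ.filter fun T : Config E => S ≤ T ∧ G.WalkAvoiding T (G.cluster Tᶜ a) c b) ∪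
          (univ.filter fun T : Config E => S ≤ T ∧
            G.WalkAvoiding (S ⊔ (Sᶜ ⊓ Tᶜ)) (G.cluster (S ⊔ (Sᶜ ⊓ Tᶜ))ᶜ b) c a)).card :=
        Finset.card_le_card hcover
    _ ≤ (univ.filter fun T : Config E => S ≤ T ∧ G.WalkAvoiding T (G.cluster Tᶜ a) c b).card +
          (univ.filter fun T : Config E => S ≤ T ∧
            G.WalkAvoiding (S ⊔ (Sᶜ ⊓ Tᶜ)) (G.cluster (S ⊔ (Sᶜ ⊓ Tᶜ))ᶜ b) c a).card :=
        Finset.card_union_le _ _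
    _ = _ := by rw [hbij]

end Cube

end MultiGraph

end PercRepro
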